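import Literature.Probability.RandomPlanarGeometry.YangBaxterSAWExcursionJordan
import HarnessLib

/-!
# Barrier catalogue (SAWScalingLimit): the two routes to the FAR CELL of a hole root carry REAL class terms
— the algebraic half of the lane's far-cell half law

Companion of `PlaquetteWalkHoleRootFarCell` / `PlaquetteWalkHoleRootConfinement` (this catalogue) and of
`YangBaxterSAWUnwoundPlaquette` (topic `RandomPlanarGeometry`), whose Part 6a writes Glazman–Manolescu's
Lemma-2.1 defect of any root at any rhombus as `i · Σ_{wound walks} classTerm`,
`classTerm = extWeight · phase(WP) · sin((5/8)(WE − excursionWinding)) · backBracket(θ; z₀, z₁, z₂, z₃)`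
(`ΩG.sum_g_eq_I_mul_sum_classTerm`), and tabulates the `backBracket`s in closed form.

At the FAR CELL `f` of a hole root (the plaquette across the hole from the root plaquette `w`, its side `E`
towards the hole dead, root on a vertical mid-edge, `W`-root normalisation) the venture lane's exact
enumerations («pcv-sawmu», seat b-engine-1, HOME finding «hole-neighbour directions», 2026-08-24: eleven
hole roots in ℤ[ζ₆₄] / ℤ[ζ₁₉₂]) show that the wound walks of class `B2a` come in exactly two routes — the
prefix passes OVER the hole and enters `f` from `N` (total turning `WP = π + θ`: the lattice directions
`E, N, W, S` are separated by `θ, π − θ, θ, π − θ`), pattern `(N, W, S; E)`, or UNDER it and enters from `S`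
(`WP = θ − 2π`), pattern `(S, W, N; E)` (with their reversed partners inside the same groups) — and that the
defect at `f` is purely imaginary times the root phase. This file proves the ALGEBRAIC half of that
statement from the tree's closed forms, for every `θ`:

* `phase_over_mul_backBracket_N_W_S_E` : `phase (π + θ) · backBracket θ N W S E = −v(θ)`;
* `phase_under_mul_backBracket_S_W_N_E` : `phase (θ − 2π) · backBracket θ S W N E = −v(θ)`;
* and the first piece of the COMBINATORIAL half (rigidity (R1)), for every finite face domain:
  `ΩG.chordSign_firstSide_eq_chordSign_dead` — at a plaquette `r` whose dead side `σ` is a side of the exterior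
  face carrying the root, every WOUND class-`B2a` walk has its first side `z₀` on the same side of the chord
  as `σ` (`chordSign(z₀; z₁, z₂) = chordSign(σ; z₁, z₂)`: the winding angle of the excursion polygon is one
  number at the root, at `midPt(r.side z₀)` (transport along the prefix) and at `midPt(r.side σ)` (transport
  through the exterior face, `ΩG.AJ_midPt_dead_eq_AJ_ctr`), and the sign rule of
  `YangBaxterSAWExcursionJordan` evaluates it at both); hence `ΩG.firstSide_ne_opp_of_wound`: no wound
  excursion after an entry from the side opposite the hole — at the far cell, `z₀ ≠ W`; with
  `ΩG.firstSide_ne_dead` (the first hit is a door) this gives `ΩG.firstSide_lateral_of_wound`: the first side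
  of a wound walk at a hole-adjacent plaquette is one of the two LATERAL sides (at the far cell `z₀ ∈ {N, S}`:
  the lane's two routes).

So on both routes `phase(WP) · backBracket` is the SAME real number `−v(θ)`: each wound group at the far
cell contributes `∓ extWeight · v(θ)` to `Σ classTerm`, the two routes with opposite signs
(`sin((5/8)(WE − excursionWinding)) = ∓1`), and the defect is `i · v(θ) · (m₊ − m₋)` up to the root phase,
`m±` the masses of the two routes — whence the lane's (R-9′) mirror zeros at `θ = π/2` (mirror symmetry in the
root axis exchanges the routes; the printed weights are mirror-invariant exactly at `θ = π/2`). Of the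
COMBINATORIAL half (that only these two routes occur, with these turnings and orientations) this file proves
the first-side chord rule (R1); the turning rigidity (R2: `WP ∈ {π + θ, θ − 2π}`, a Hopf argument on the prefix
closed through `r` and the hole) and the orientation (R3) are NOT proved here, and nothing depends on them.

References: A. Glazman, I. Manolescu, arXiv:1708.00395v3, Lemma 2.1 [GlazmanManolescu2019]; A. Glazman,
Electron. Commun. Probab. 20 (2015) no. 86, Lemma 3.1 and eq. (1) (the weights `v(θ)` etc.)
[Glazman2015WeightedSAW]; H. Duminil-Copin, S. Smirnov, Ann. of Math. 175 (2012), Lemma 1 (proof: the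
winding bookkeeping) [DuminilCopinSmirnov2012]. Status: lane lemma (two exponential identities on the tree's
closed forms); the half law itself is the lane's, OPEN. Written for the venture lane «pcv-sawmu»
(Tier B SEARCH 1, b-engine-1 gen 16).
-/

noncomputable section

namespace Literature.Probability.RandomPlanarGeometry.SAW.YangBaxter

open Real Complex

/-- Two phases multiply by adding the angles. [cite: Glazman2015WeightedSAW, Lemma 3.1 (proof: the phase factors e^{−iσ·winding})] -/
private theorem exp_mul_I_mul_exp_mul_I (a b : ℝ) :
    Complex.exp (((a : ℝ) : ℂ) * Complex.I) * Complex.exp (((b : ℝ) : ℂ) * Complex.I) =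
      Complex.exp ((((a + b : ℝ)) : ℂ) * Complex.I) := by
  rw [← Complex.exp_add]; congr 1; push_cast; ring

/-- ★ **Over-route**: the prefix that passes over the hole and enters the far cell from `N` has total turning
`π + θ`; with the tree's `backBracket_N_W_S_E` the product `phase(WP) · backBracket` is the REAL number
`−v(θ)`. [cite: Glazman2015WeightedSAW, Lemma 3.1, eq. (1) (the weight v(θ))] [cite: GlazmanManolescu2019, Lemma 2.1 (proof: [Gl])] -/
theorem phase_over_mul_backBracket_N_W_S_E (θ : ℝ) :
    phase (π + θ) * backBracket θ .N .W .S .E = -(weightV θ : ℂ) := by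
  rw [backBracket_N_W_S_E, phase]
  rw [show Complex.exp ((((-(5 / 8 * (π + θ))) : ℝ) : ℂ) * Complex.I) *
      (-(weightV θ : ℂ) * Complex.exp (((5 * θ / 8 + 5 * π / 8 : ℝ) : ℂ) * Complex.I)) =
      -(weightV θ : ℂ) * (Complex.exp ((((-(5 / 8 * (π + θ))) : ℝ) : ℂ) * Complex.I) *
        Complex.exp (((5 * θ / 8 + 5 * π / 8 : ℝ) : ℂ) * Complex.I)) by ring,
    exp_mul_I_mul_exp_mul_I, show (-(5 / 8 * (π + θ)) + (5 * θ / 8 + 5 * π / 8) : ℝ) = 0 by ring]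
  simp

/-- ★ **Under-route**: the prefix that passes under the hole and enters the far cell from `S` has total
turning `θ − 2π`; with `backBracket_S_W_N_E` the product is the same real number `−v(θ)`.
[cite: Glazman2015WeightedSAW, Lemma 3.1, eq. (1) (the weight v(θ))] [cite: GlazmanManolescu2019, Lemma 2.1 (proof: [Gl])] -/
theorem phase_under_mul_backBracket_S_W_N_E (θ : ℝ) :
    phase (θ - 2 * π) * backBracket θ .S .W .N .E = -(weightV θ : ℂ) := by
  rw [backBracket_S_W_N_E, phase]
  rw [show Complex.exp ((((-(5 / 8 * (θ - 2 * π))) : ℝ) : ℂ) * Complex.I) *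
      (-(weightV θ : ℂ) * Complex.exp (((5 * θ / 8 - 5 * π / 4 : ℝ) : ℂ) * Complex.I)) =
      -(weightV θ : ℂ) * (Complex.exp ((((-(5 / 8 * (θ - 2 * π))) : ℝ) : ℂ) * Complex.I) *
        Complex.exp (((5 * θ / 8 - 5 * π / 4 : ℝ) : ℂ) * Complex.I)) by ring,
    exp_mul_I_mul_exp_mul_I, show (-(5 / 8 * (θ - 2 * π)) + (5 * θ / 8 - 5 * π / 4) : ℝ) = 0 by ring]
  simp

/-- **The two routes agree**: `phase(π + θ) · backBracket θ N W S E = phase(θ − 2π) · backBracket θ S W N E` —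
the over- and under-route wound groups at the far cell point the same (real) way, so they can cancel only by
mass (the lane's (R-9′) mirror zeros). [cite: GlazmanManolescu2019, Lemma 2.1 (proof: [Gl])] -/
theorem farCell_routes_agree (θ : ℝ) :
    phase (π + θ) * backBracket θ .N .W .S .E = phase (θ - 2 * π) * backBracket θ .S .W .N .E := by
  rw [phase_over_mul_backBracket_N_W_S_E, phase_under_mul_backBracket_S_W_N_E]

/-! ## The chord rule at a plaquette adjacent to the root's exterior face (the combinatorial input (R1))

For a class-`B2a` walk at a rhombus `r` one of whose sides `σ` is a side of the exterior face `g ∉ D` that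
carries the root `a` (a plaquette adjacent to the root's hole, `σ` its dead side): the winding angle of the
excursion polygon `J` is the same at the midpoint of the root, at the midpoint of the first side `z₀` (transport
along the prefix, parent file) and at the midpoint of the dead side `σ` (transport through `g`, below). The sign
rule of `YangBaxterSAWExcursionJordan` evaluates both as `0` or `2π · chordSign(·; z₁, z₂)`; so for a WOUND walk the
first side and the dead side lie on the same side of the chord: `chordSign(z₀; z₁, z₂) = chordSign(σ; z₁, z₂)`, and in
particular `z₀` is never the side opposite to `σ` — at the far cell no wound excursion belongs to a walk that first
reached the cell from the far side. -/

open private far_ctr far_midPt sdot_pJpt_of_far AJ_eq_AJ_of_sdot pJpt_cases' sdot_midPt_ctr_pos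
  from Literature.Probability.RandomPlanarGeometry.YangBaxterSAWGeneralDomain

/-- `x² + y² ≥ 5` from coordinate bounds. [cite: GlazmanManolescu2019, §1 (the lattice of rhombi and its mid-edges)] -/
private theorem five_le_sq_add_sq' {x y : ℤ}
    (h : (x ≤ -3 ∨ 3 ≤ x) ∨ (y ≤ -3 ∨ 3 ≤ y) ∨ ((x ≤ -2 ∨ 2 ≤ x) ∧ (y ≤ -1 ∨ 1 ≤ y)) ∨
      ((y ≤ -2 ∨ 2 ≤ y) ∧ (x ≤ -1 ∨ 1 ≤ x))) : 5 ≤ x ^ 2 + y ^ 2 := by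
  rcases h with (h | h) | (h | h) | ⟨h1 | h1, h2 | h2⟩ | ⟨h1 | h1, h2 | h2⟩ <;> nlinarith [sq_nonneg x, sq_nonneg y]

/-- An inner point of a face is at squared distance `≥ 5` from the midpoint of every edge other than the side it
sits next to. [cite: GlazmanManolescu2019, §1 (the lattice of rhombi and its mid-edges)] -/
theorem five_le_distSq_innerPt_midPt_of_ne {g : Face} {z : Side} {e : MidEdge} (h : g.side z ≠ e) :
    5 ≤ ((innerPt g z).1 - (midPt e).1) ^ 2 + ((innerPt g z).2 - (midPt e).2) ^ 2 := by
  obtain ⟨k, j⟩ := g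
  refine five_le_sq_add_sq' ?_
  rcases e with ⟨k', j'⟩ | ⟨k', j'⟩ <;> cases z <;>
    simp [innerPt, Face.base, Side.inOff, Side.offset, Side.nIn, midPt, Face.side] at h ⊢ <;> omega

variable {D : Set Face} {a : MidEdge} {r : Face}

namespace YBWalk

/-- The `i`-th arc read through `nth`. [cite: GlazmanManolescu2019, §1 (the lattice of rhombi and its mid-edges)] -/
theorem arcFace_nth_eq_some_fc {z : MidEdge} (γ : YBWalk D a z) {i : ℕ} (hi : i < γ.arcs.length) :
    arcFace (γ.nth i, γ.nth (i + 1)) = some (γ.fc i) := by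
  have h1 := (YBWalk.arcFace_arcAt (γ := γ) hi).1
  have hl := γ.length_eq
  rwa [YBWalk.arcAt_eq hi, ← γ.nth_eq_getElem (by omega), ← γ.nth_eq_getElem (by omega)] at h1

end YBWalk

namespace ΩG

variable {ω : ΩG D a r} (hr : RootedFace D a r)

/-- **`J` stays `≥ 5` (squared) away from the midpoint of a dead side**: if the side `σ` of `r` is neither the
exit nor the return side and its other face `g` lies outside the domain, every vertex of the excursion polygon is
at squared distance `≥ 5` from `midPt (r.side σ)` (the vertices are inner points of excursion faces — in `D`,
not `r`, hence not faces of that edge — or the two chord ends `innerPt r z₁`, `innerPt r z₂`).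
[cite: Glazman2015WeightedSAW, Lemma 3.1 (proof: the winding of the grouped walks)] -/
theorem five_le_distSq_pJpt_midPt_dead (h : ω.IsB2a) {σ : Side} (hσ1 : σ ≠ ω.z1 hr h) (hσ2 : σ ≠ ω.1)
    {g : Face} (hg : g ∉ D) (hgr : g ≠ r) {s : Side} (hgs : g.side s = r.side σ) {k : ℕ} (hk : k ≤ 2 * ω.Mv) :
    5 ≤ ((ω.pJpt hr h k).1 - (midPt (r.side σ)).1) ^ 2 + ((ω.pJpt hr h k).2 - (midPt (r.side σ)).2) ^ 2 := by
  -- the two faces of the edge `r.side σ` are `r` and `g`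
  have faces_of_edge : ∀ f : Face, (∃ t, f.side t = r.side σ) → f = r ∨ f = g := by
    intro f hf
    have hr' := (Face.exists_side_eq_iff r (r.side σ)).1 ⟨σ, rfl⟩
    have hg' := (Face.exists_side_eq_iff g (r.side σ)).1 ⟨s, hgs⟩
    have hf' := (Face.exists_side_eq_iff f (r.side σ)).1 hf
    rcases hf' with e | e <;> rcases hr' with e1 | e1 <;> rcases hg' with e2 | e2
    all_goals first
      | exact Or.inl (e.trans e1.symm)
      | exact Or.inr (e.trans e2.symm)
      | exact absurd (e1.trans e2.symm) hgr.symm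
  rcases pJpt_cases' (ω := ω) (hr := hr) h hk with ⟨i, hi1, hi2, e | e⟩ | e | e
  · rw [e]
    refine five_le_distSq_innerPt_midPt_of_ne fun hh => ?_
    have hD := (YBWalk.arcFace_arcAt (γ := ω.2) hi2).2
    rcases faces_of_edge _ ⟨_, hh⟩ with e1 | e1
    · exact YBWalk.arcFace_ne_of_excursionG (γ := ω.2) hr h.1 hi1 (by rw [h.2]; exact hi2)
        (by rw [ω.2.arcFace_nth_eq_some_fc hi2, e1])
    · exact hg (e1 ▸ hD)
  · rw [e]
    refine five_le_distSq_innerPt_midPt_of_ne fun hh => ?_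
    have hD := (YBWalk.arcFace_arcAt (γ := ω.2) hi2).2
    rcases faces_of_edge _ ⟨_, hh⟩ with e1 | e1
    · exact YBWalk.arcFace_ne_of_excursionG (γ := ω.2) hr h.1 hi1 (by rw [h.2]; exact hi2)
        (by rw [ω.2.arcFace_nth_eq_some_fc hi2, e1])
    · exact hg (e1 ▸ hD)
  · rw [e]; exact five_le_distSq_innerPt_midPt_of_ne fun hh => hσ1 (Face.side_injective r hh).symm
  · rw [e]; exact five_le_distSq_innerPt_midPt_of_ne fun hh => hσ2 (Face.side_injective r hh).symm

/-- **Transport from the midpoint of a dead side to the centre of the exterior face behind it.**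
[cite: Glazman2015WeightedSAW, Lemma 3.1 (proof: the winding of the grouped walks)] -/
theorem AJ_midPt_dead_eq_AJ_ctr (h : ω.IsB2a) {σ : Side} (hσ1 : σ ≠ ω.z1 hr h) (hσ2 : σ ≠ ω.1)
    {g : Face} (hg : g ∉ D) {s : Side} (hgs : g.side s = r.side σ) :
    ω.AJ hr h (toC (midPt (r.side σ))) = ω.AJ hr h (toC (Face.ctr g)) := by
  have hgr : g ≠ r := fun e => hg (e ▸ hr.mem)
  refine AJ_eq_AJ_of_sdot (ω := ω) (hr := hr) h _ _ (fun k hk => ?_) (fun k hk => ?_) (fun k hk => ?_)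
  · exact sdot_pJpt_of_far (ω := ω) (hr := hr) h _
      (fun k' hk' => five_le_distSq_pJpt_midPt_dead hr h hσ1 hσ2 hg hgr hgs hk') hk
  · exact sdot_pJpt_of_far (ω := ω) (hr := hr) h _
      (fun k' hk' => le_trans (by norm_num) (far_ctr (ω := ω) (hr := hr) h hg hk')) hk
  · have hz := sdot_midPt_ctr_pos g s (far_ctr (ω := ω) (hr := hr) h hg hk) (far_midPt (ω := ω) (hr := hr) h (g.side s) hk)
    rw [hgs] at hz
    exact hz

/-- The winding of `J` at the midpoint of the first side equals its winding at the root (the parent file's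
transport along the prefix, in `midPt` form). [cite: Glazman2015WeightedSAW, Lemma 3.1 (proof: the winding of the grouped walks)] -/
theorem AJ_midPt_firstSide_eq_AJ_root (h : ω.IsB2a) :
    ω.AJ hr h (toC (midPt (r.side ω.2.firstSideG))) = ω.AJ hr h (toC (midPt a)) := by
  rw [← ω.AJ_qQ_zero_eq_AJ_root (hr := hr) (h := h), ΩG.qQ, ω.Qp_zero (hr := hr) h, midPt_side]

/-- ★★ **The chord rule at a plaquette adjacent to the root's hole.** If the dead side `σ` of `r` (neither exit
nor return side) is a side of an exterior face `g ∉ D` that also carries the root `a`, then for every WOUND walk of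
class `B2a` at `r` the first side `z₀` and the dead side `σ` lie on the same side of the chord:
`chordSign(z₀; z₁, z₂) = chordSign(σ; z₁, z₂)`. [cite: GlazmanManolescu2019, Lemma 2.1 (proof: [Gl])]
[cite: Glazman2015WeightedSAW, Lemma 3.1 (proof, pp. 6–7: the classes of walks through a rhombus)]
[cite: DuminilCopinSmirnov2012, proof of Lemma 1 (the winding bookkeeping)] -/
theorem chordSign_firstSide_eq_chordSign_dead (h : ω.IsB2a) {σ : Side} (hσ1 : σ ≠ ω.z1 hr h) (hσ2 : σ ≠ ω.1)
    {g : Face} (hg : g ∉ D) {s s' : Side} (hgs : g.side s = r.side σ) (hga : g.side s' = a)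
    (hw : ω.AJ hr h (toC (midPt a)) ≠ 0) :
    chordSign ω.2.firstSideG (ω.z1 hr h) ω.1 = chordSign σ (ω.z1 hr h) ω.1 := by
  have hd := ω.2.sides_distinctG hr h.1
  rw [ω.returnSide_of_isB2a h] at hd
  have hz01 : ω.2.firstSideG ≠ ω.z1 hr h := by unfold ΩG.z1; exact fun e => hd.1 e.symm
  have hz02 : ω.2.firstSideG ≠ ω.1 := fun e => hd.2.1 e.symm
  -- the winding at the first side is the winding at the root
  have h0 := ω.AJ_midPt_firstSide_eq_AJ_root hr h
  -- the winding at the dead side is the winding at the root (through `g`)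
  have hσ := (ω.AJ_midPt_dead_eq_AJ_ctr hr h hσ1 hσ2 hg hgs).trans (ω.AJ_root_eq_AJ_ctr (hr := hr) h hg hga).symm
  -- the sign rule at both midpoints
  rcases ω.AJ_midPt_side_eq (hr := hr) h hz01 hz02 with e0 | e0
  · exact absurd (h0 ▸ e0) hw
  rcases ω.AJ_midPt_side_eq (hr := hr) h hσ1 hσ2 with e1 | e1
  · exact absurd (hσ ▸ e1) hw
  have key : (2 * Real.pi * (chordSign ω.2.firstSideG (ω.z1 hr h) ω.1 : ℝ)) =
      2 * Real.pi * (chordSign σ (ω.z1 hr h) ω.1 : ℝ) := by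
    rw [← e0, ← e1, h0, hσ]
  have h2 : (2 * Real.pi : ℝ) ≠ 0 := mul_ne_zero two_ne_zero Real.pi_ne_zero
  exact_mod_cast mul_left_cancel₀ h2 key

/-- Opposite sides lie on opposite sides of the chord joining the inner points of the two remaining sides.
[cite: GlazmanManolescu2019, §1 (the lattice of rhombi and its mid-edges)] -/
theorem chordSign_opp_ne : ∀ σ z₁ z₂ : Side, z₁ ≠ σ → z₁ ≠ σ.opp → z₂ ≠ σ → z₂ ≠ σ.opp → z₁ ≠ z₂ →
    chordSign σ.opp z₁ z₂ ≠ chordSign σ z₁ z₂ := by decide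

/-- ★★ **No wound excursion after a far-side entry**: in the situation of the chord rule the walk did not first
reach `r` through the side opposite to the dead side. At the far cell of a hole root (dead side towards the hole)
this is the lane's rigidity (R1): a wound class-`B2a` walk enters the far cell from a lateral side, never from
the far side. [cite: GlazmanManolescu2019, Lemma 2.1 (proof: [Gl])]
[cite: Glazman2015WeightedSAW, Lemma 3.1 (proof, pp. 6–7: the classes of walks through a rhombus)] -/
theorem firstSide_ne_opp_of_wound (h : ω.IsB2a) {σ : Side} (hσ1 : σ ≠ ω.z1 hr h) (hσ2 : σ ≠ ω.1)
    {g : Face} (hg : g ∉ D) {s s' : Side} (hgs : g.side s = r.side σ) (hga : g.side s' = a)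
    (hw : ω.AJ hr h (toC (midPt a)) ≠ 0) : ω.2.firstSideG ≠ σ.opp := by
  intro hopp
  have hd := ω.2.sides_distinctG hr h.1
  rw [ω.returnSide_of_isB2a h] at hd
  have hz1 : ω.z1 hr h ≠ σ.opp := by unfold ΩG.z1; rw [← hopp]; exact hd.1
  have hz2 : ω.1 ≠ σ.opp := by rw [← hopp]; exact hd.2.1
  have hz12 : ω.z1 hr h ≠ ω.1 := by unfold ΩG.z1; exact fun e => hd.2.2 e.symm
  have key := ω.chordSign_firstSide_eq_chordSign_dead hr h hσ1 hσ2 hg hgs hga hw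
  rw [hopp] at key
  exact chordSign_opp_ne σ (ω.z1 hr h) ω.1 (Ne.symm hσ1) hz1 (Ne.symm hσ2) hz2 hz12 key

/-- Two distinct faces of the domain with a common side make that side a door (both its faces in `D`).
[cite: GlazmanManolescu2019, §1 (the lattice of rhombi and its mid-edges)] -/
private theorem door_of_two_faces' {e : MidEdge} {f f' : Face} (hf : ∃ s, f.side s = e) (hf' : ∃ s, f'.side s = e)
    (hne : f ≠ f') (hD : f ∈ D) (hD' : f' ∈ D) : e.faces.1 ∈ D ∧ e.faces.2 ∈ D := by
  rcases (Face.exists_side_eq_iff f e).1 hf with h1 | h1 <;> rcases (Face.exists_side_eq_iff f' e).1 hf' with h2 | h2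
  · exact absurd (h1.trans h2.symm) hne
  · exact ⟨h1 ▸ hD, h2 ▸ hD'⟩
  · exact ⟨h2 ▸ hD', h1 ▸ hD⟩
  · exact absurd (h1.trans h2.symm) hne

/-- ★ **The first side is never the dead side** (unless the root itself is a side of `r`): the first hit of
`∂r` by a class-`B2a` walk is a crossed mid-edge — the exit of the previous arc (in a face of `D` other than `r`)
and the entry of the arc inside `r` — hence a door, whereas the dead side `σ` has the exterior face `g ∉ D`
behind it. [cite: Glazman2015WeightedSAW, Lemma 3.1 (proof, pp. 6–7: the classes of walks through a rhombus)] -/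
theorem firstSide_ne_dead (hr : RootedFace D a r) (h : ω.IsB2a) {σ : Side} {g : Face} (hg : g ∉ D) {s : Side}
    (hgs : g.side s = r.side σ) (hra : ∀ t : Side, r.side t ≠ a) : ω.2.firstSideG ≠ σ := by
  intro hz
  set γ := ω.2 with hγ
  have hfh : γ.firstHitG < γ.arcs.length := ω.fh_lt h
  have hnth := γ.nth_firstHitG
  rw [hz] at hnth
  rcases Nat.eq_zero_or_pos γ.firstHitG with h0 | hpos
  · rw [h0, γ.nth_zero] at hnth
    exact hra σ hnth.symm
  · -- the arc before the first hit lies in a face of `D` other than `r`, the arc at the first hit in `r`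
    have hl := γ.length_eq
    obtain ⟨-, hout, -⟩ := YBWalk.side_sIn (γ := γ) (i := γ.firstHitG - 1) (by omega)
    rw [← γ.nth_eq_getElem (by omega), show γ.firstHitG - 1 + 1 = γ.firstHitG by omega, hnth] at hout
    have hDprev := (YBWalk.arcFace_arcAt (γ := γ) (i := γ.firstHitG - 1) (by omega)).2
    have hne : γ.fc (γ.firstHitG - 1) ≠ r := by
      intro e
      have h1 := γ.arcFace_nth_eq_some_fc (i := γ.firstHitG - 1) (by omega)
      rw [e] at h1
      exact YBWalk.arcFace_ne_of_lt_firstHitG (γ := γ) (i := γ.firstHitG - 1) (by omega) (by omega) h1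
    have hdoor := door_of_two_faces' (D := D) ⟨_, hout⟩ ⟨σ, rfl⟩ hne hDprev hr.mem
    -- but `g ∉ D` is a face of that edge
    rcases (Face.exists_side_eq_iff g (r.side σ)).1 ⟨s, hgs⟩ with e | e
    · exact hg (e ▸ hdoor.1)
    · exact hg (e ▸ hdoor.2)

/-- ★★ **At a hole-adjacent plaquette a wound excursion belongs to a walk that entered through a LATERAL side**:
the first side is neither the dead side nor the side opposite to it. (At the far cell of a hole root: `z₀ ∈ {N, S}`
in the `W`-root normalisation — the lane's two routes, over and under the hole.)
[cite: GlazmanManolescu2019, Lemma 2.1 (proof: [Gl])] [cite: Glazman2015WeightedSAW, Lemma 3.1 (proof, pp. 6–7)] -/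
theorem firstSide_lateral_of_wound (h : ω.IsB2a) {σ : Side} (hσ1 : σ ≠ ω.z1 hr h) (hσ2 : σ ≠ ω.1)
    {g : Face} (hg : g ∉ D) {s s' : Side} (hgs : g.side s = r.side σ) (hga : g.side s' = a)
    (hra : ∀ t : Side, r.side t ≠ a) (hw : ω.AJ hr h (toC (midPt a)) ≠ 0) :
    ω.2.firstSideG ≠ σ ∧ ω.2.firstSideG ≠ σ.opp :=
  ⟨ω.firstSide_ne_dead hr h hg hgs hra, ω.firstSide_ne_opp_of_wound hr h hσ1 hσ2 hg hgs hga hw⟩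

end ΩG

end Literature.Probability.RandomPlanarGeometry.SAW.YangBaxter
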